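import Literature.MathematicalPhysics.QuantumLattice.HubbardOpenBoxGeneralPairClusterOracle
import Literature.MathematicalPhysics.QuantumLattice.HubbardNNNHoppingClusterEmbedding
import HarnessLib

/-!
# General-pair cluster: kernel sector floors ⇒ the operator inequality `h^G − q₀·1 ⪰ 0`

Topic `MathematicalPhysics/QuantumLattice`, family `hubbard`. The consumers of window certificates for the three-band
(Emery) model (`le_emeryEnergyDensity_of_cuO4Certificate`, `emeryBoxLa214v122_cuprate_energyFloor54_of_cuO4Certificates`;
hubbard-downfold-mod-4 / hubbard-box-p1) take the hypothesis `PosSemidef (H^w − q₀•1)` on the window Hamiltonian, while the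
kernel device (`HubbardOpenBoxGeneralPairClusterOracle`) delivers SECTOR floors `q ≤ E₀(h^G, k)` for every particle number.
This file is the glue for the general-pair cluster `hubbardOpenBoxGP a b τ υ ν` (any symmetric hopping table): particle-number
conservation (`hubbardOpenBoxGP_commute_totalNumber`) + the tree's `posSemidef_sub_smul_one_of_forall_le_groundEnergy` ⇒
**`posSemidef_hubbardOpenBoxGP_sub_smul_one_of_sectors`**, and the certificate form
**`posSemidef_hubbardOpenBoxGP_sub_of_kCertsGP₃`** straight from kernel certificates.

Everything is proved; no named fact; nothing numerical.

## References

* V. J. Emery, PRL 58 (1987) 2794, eq. (1). [cite: Emery1987, eq. (1)]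
* I. Kull, N. Schuch, B. Dive, M. Navascués, PRX 14 (2024) 021008, §5.3. [cite: KullEtAl2024, §5.3]
* E. H. Lieb, PRL 62 (1989) 1201, proof of Thm 1 (sectors). [cite: LiebPRL1989, proof of Theorem 1]
-/

noncomputable section

namespace Literature.MathematicalPhysics.QuantumLattice

open Matrix Finset HubbardWave0
open scoped ComplexOrder

namespace ClusterLowerBound

variable {a b : ℕ}

/-- **`[h^G, N̂] = 0`** (spin-diagonal hoppings, occupation-number interactions). [cite: LiebPRL1989, proof of Theorem 1] -/
theorem hubbardOpenBoxGP_commute_totalNumber (τ : Fin a ×ₗ Fin b → Fin a ×ₗ Fin b → ℝ) (υ ν : Fin a ×ₗ Fin b → ℝ) :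
    Commute (hubbardOpenBoxGP a b τ υ ν) totalNumber := by
  rw [LiebThm1.totalNumber_eq_diagonal]
  exact (preservesSectors_hubbardOpenBoxGP τ υ ν).commute_diagonal fun p q => ((p + q : ℕ) : ℂ)

/-- **Sector floors ⇒ `h^G − q•1 ⪰ 0`**: if `q ≤ E₀(h^G, k)` for every particle number `k ≤ 2ab` (`τ` symmetric), then
`hubbardOpenBoxGP a b τ υ ν − q•1` is positive semidefinite on the whole cluster Fock space. [cite: KullEtAl2024, §5.3] -/
theorem posSemidef_hubbardOpenBoxGP_sub_smul_one_of_sectors (τ : Fin a ×ₗ Fin b → Fin a ×ₗ Fin b → ℝ)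
    (hτ : ∀ x y, τ x y = τ y x) (υ ν : Fin a ×ₗ Fin b → ℝ) {q : ℝ}
    (hq : ∀ k ≤ 2 * (a * b), q ≤ groundEnergy (hubbardOpenBoxGP a b τ υ ν) k) :
    (hubbardOpenBoxGP a b τ υ ν - (q : ℂ) • (1 : Matrix (Finset (Orb (Fin a ×ₗ Fin b))) (Finset (Orb (Fin a ×ₗ Fin b))) ℂ)).PosSemidef := by
  refine posSemidef_sub_smul_one_of_forall_le_groundEnergy (hubbardOpenBoxGP_isHermitian τ hτ υ ν)
    (hubbardOpenBoxGP_commute_totalNumber τ υ ν) fun N hN => hq N ?_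
  rw [card_rectSites] at hN
  exact hN

end ClusterLowerBound

namespace OccupationCode

open ClusterLowerBound Literature.Computation.Certificates

/-- **Certificate form of the operator inequality**: kernel certificates of every spin sector (`p ≤ q`) of every particle
number `k ≤ 2ab` of the general-pair cluster with tables `(W/Q, V/Q, M/Q)` (`W` symmetric) and a common floor `q₀ ≤` every
sector floor ⇒ `hubbardOpenBoxGP a b (W/Q) (V/Q) (M/Q) − q₀•1 ⪰ 0` — the `hq` hypothesis of the Cu–O window laws.
[cite: KullEtAl2024, §5.3] [cite: Emery1987, eq. (1)] -/
theorem posSemidef_hubbardOpenBoxGP_sub_of_kCertsGP₃ (a b : ℕ) (W : ℕ → ℕ → ℤ) (hW : ∀ P Q, W P Q = W Q P) (V M : ℕ → ℤ)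
    (Q : ℕ) (q₀ : ℚ) (Ls : ℕ → ℕ → List ℕ) (certs : ℕ → ℕ → KCert)
    (hpass : ∀ k ≤ 2 * (a * b), ∀ p ≤ k, p ≤ k - p → (certs k p).PassesG (gpCluster a b W V M) a b p (k - p) Q (Ls k p))
    (hσ : ∀ k ≤ 2 * (a * b), ∀ p ≤ k, p ≤ k - p → q₀ ≤ (certs k p).floor Q) :
    (hubbardOpenBoxGP a b (fun x y => (W (siteRank x) (siteRank y) : ℝ) / Q) (fun x => (V (siteRank x) : ℝ) / Q)
        (fun x => (M (siteRank x) : ℝ) / Q) -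
      ((q₀ : ℝ) : ℂ) • (1 : Matrix (Finset (Orb (Fin a ×ₗ Fin b))) (Finset (Orb (Fin a ×ₗ Fin b))) ℂ)).PosSemidef :=
  posSemidef_hubbardOpenBoxGP_sub_smul_one_of_sectors _ (fun x y => by simp only [hW (siteRank x) (siteRank y)]) _ _
    fun k hk => groundEnergy_ge_of_kCertsGP₃ a b W hW V M Q hk q₀ (Ls k) (certs k) (hpass k hk) (hσ k hk)

end OccupationCode

end Literature.MathematicalPhysics.QuantumLattice
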